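import Literature.AlgebraicGeometry.Hyperkaehler.K3HilbertType
import Literature.AlgebraicGeometry.HodgeTheory.RationalHodgeClasses
import Literature.AlgebraicGeometry.HodgeTheory.AlgebraicClasses
import Mathlib.RingTheory.RootsOfUnity.PrimitiveRoots
import HarnessLib

/-!
# A `K3^[2]`-type fourfold with a non-symplectic automorphism of order `23` (Boissière–Camere–Mongardi–Sarti 2016) — NAMED FACT

Layer `Literature/AlgebraicGeometry/Hyperkaehler`. S. Boissière, C. Camere, G. Mongardi, A. Sarti,
*Isometries of ideal lattices and hyperkähler manifolds*, Int. Math. Res. Not. 2016 (4) 963–977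
(arXiv:1407.1814, READ: materialised pp. 3, 5–6, 10), Theorem 1.1 = Theorem 6.1 (§6, p. 10):

> **Theorem 6.1.** There exists an IHS-`K3^[2]` with a non-symplectic automorphism of order `23`.
> This variety `X` and its automorphism `f` have the following properties:
> * `ρ(X) = 1`, `NS(X) ≅ ⟨46⟩` and `Trans(X) ≅ E₈^{⊕2} ⊕ U^{⊕2} ⊕ K₂₃`;
> * `Inv(f) = NS(X)` and `Orth(f) = Trans(X)`.

with §1 (p. 3): "`f` acts on `H^{2,0}(X)` by multiplication by a primitive `p`-th root of the unity.
Such automorphisms can exist only when `X` is projective. […] the characteristic polynomial of the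
action of `f` on the transcendental lattice `Trans(X)` is a multiple `k` of the `p`-th cyclotomic
polynomial `Φ_p`. Thus `k φ(p) = rank_ℤ Trans(X)` […] Since `b₂(X) = 23`, the maximal order for `f`
is `p = 23` and this can happen only when `ρ(X) = 1`", §3 (pp. 5–6): "Since `f` acts
non-symplectically one has `Trans(X) ⊂ Orth(f)` […] if `m_f = 1` this forces `Trans(X) = Orth(f)`
and consequently `NS(X) = Inv(f)`. Since `1` is not an eigenvalue of `f^*|_{Orth(f)}` the
characteristic polynomial of `f^*|_{Orth(f)}` is `Φ_p`. […] If `p = 23` the only possibility is that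
`m_f = 1`", the proof of Thm. 6.1 (p. 10: an order-`23` isometry of `U^{⊕3} ⊕ E₈^{⊕2} ⊕ ⟨−2⟩` built
from an ideal lattice of `ℤ[ζ₂₃]` (Bayer-Fluckiger), surjectivity of the period map, "the generator
of `NS(X) ≅ T` is an ample class", the Global Torelli theorem of Markman–Verbitsky, injectivity of
`Aut(X) → O(H²(X, ℤ))`), and Remark 6.2 (uniqueness of `(X, f)`).  It answers the existence question
left open for `p = 23` in Boissière–Camere–Sarti, Kyoto J. Math. 56 (2016) (arXiv:1402.5154), Rem. 7.3.

Consumer: cell `hodge-nonav`, planner route memo ROUTE-P1X (chapter EXT, row EX11: smooth projective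
threefolds `Y` with `h^{2,0}(Y) = 1` and an automorphism of finite order `m` on `T²(Y)` with
`φ(m) = dim T²(Y)_ℚ`); the smooth `f`-stable hyperplane sections `Y ⊂ X` of this fourfold are the
extreme instance (`ρ(Y) = 1`, `dim T²(Y) = 22 = φ(23)`) by the tree's Lefschetz hyperplane theorem
`HodgeTheory.bijective_complexBettiMap_hypersurfaceSection_of_lt` (cell dossier LIT-DOSSIER §65).

## Rendering (tree carriers) and design

* `X` smooth projective of dimension `4` (`Motives.IsSmoothProjective 4 X`; "such automorphisms can
  exist only when `X` is projective", loc. cit.) and of `K3^[2]`-type (`IsOfK3HilbertSquareType X`,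
  file `K3HilbertType`; BCMS's "IHS-`K3^[2]`" = deformation of the Hilbert square of a projective K3).
* the automorphism: `f : X ⟶ X` in `SchemeOver ℂ` with `End.of f ^ 23 = 1` and `f ≠ 𝟙 X` (order
  exactly `23`, a prime).
* NON-SYMPLECTIC, read cohomologically as in `Mongardi2011_symplecticInvolution_fixedLocus`: `f^*`
  (`HodgeTheory.complexBetti.map f 2`) multiplies the classes of Hodge type `(2,0)` of `H²(X(ℂ); ℂ)`
  (`HodgeTheory.IsOfHodgeType 4 X 2 2 0`) by one primitive `23`-rd root of unity `ζ`.
* `b₂(X) = 23`; `ρ(X) = 1` as `dim_ℂ N¹H²(X(ℂ); ℂ) = 1` (`HodgeTheory.algebraicClasses X 1`, the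
  `ℂ`-span of divisor classes); `Inv(f) = NS(X)` over `ℂ`: the `f^*`-fixed classes of `H²` are exactly
  the divisor classes.
* `Orth(f) = Trans(X)` with characteristic polynomial `Φ₂₃`, over `ℂ`: every primitive `23`-rd root of
  unity is an eigenvalue of `f^*` on `H²(X(ℂ); ℂ)` with (geometric = algebraic, `f^*` being of finite
  order) multiplicity exactly `1` — together with the previous item this is the eigenspace
  decomposition `H² = NS_ℂ ⊕ ⨁_{ζ primitive} ker(f^* − ζ)`, `1 + 22 = 23`.
* NOT rendered (need the Beauville–Bogomolov form as an INTEGRAL form / a marking, cf. "Not here" of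
  `K3HilbertType`): the isometry classes `NS(X) ≅ ⟨46⟩`, `Trans(X) ≅ E₈^{⊕2} ⊕ U^{⊕2} ⊕ K₂₃`, and the
  uniqueness of `(X, f)` (Rem. 6.2).

## What is NOT here

Any proof (period map, Torelli); the lattice isometry classes (above); the order-`23` ideal-lattice
isometry itself (Prop. 5.1, Cor. 5.2); non-natural automorphisms of other orders.

## References

* [BoissiereCamereMongardiSarti2016] S. Boissière, C. Camere, G. Mongardi, A. Sarti, Isometries of
  ideal lattices and hyperkähler manifolds, IMRN 2016, Thm. 1.1, Thm. 6.1, Rem. 6.2, §1, §3.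
* [BoissiereCamereSarti2016] S. Boissière, C. Camere, A. Sarti, Classification of automorphisms on a
  deformation family of hyper-Kähler four-folds by p-elementary lattices, Kyoto J. Math. 56 (2016),
  Rem. 7.3 (the question), §6.1 (natural automorphisms).
* [Beauville1983] A. Beauville, Variétés kählériennes dont la première classe de Chern est nulle,
  §6 Prop. 6 (`b₂(S^[2]) = 23`).
-/

noncomputable section

open CategoryTheory MonoidalCategory

namespace Literature.AlgebraicGeometry.Hyperkaehler

/-- **Boissière–Camere–Mongardi–Sarti 2016, Thm. 1.1 = Thm. 6.1 (with §1 and §3 for the cohomological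
reading).**  There is a smooth projective complex fourfold `X` of `K3^[2]`-type with an automorphism
`f` of order `23` such that: `f^*` multiplies the `(2,0)`-classes of `H²(X(ℂ); ℂ)` by a primitive
`23`-rd root of unity (non-symplectic); `b₂(X) = 23`; `ρ(X) = 1` and the `f^*`-invariant classes of
`H²(X(ℂ); ℂ)` are exactly the divisor classes (`Inv(f) = NS(X)`); and every primitive `23`-rd root of
unity is an eigenvalue of `f^*` on `H²(X(ℂ); ℂ)` of multiplicity one (`Orth(f) = Trans(X)` has rank
`22 = φ(23)` and `f^*|_{Trans(X)}` has characteristic polynomial `Φ₂₃`).  Verbatim: "There exists an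
IHS-`K3^[2]` with a non-symplectic automorphism of order `23`. This variety `X` and its automorphism
`f` have the following properties: `ρ(X) = 1`, `NS(X) ≅ ⟨46⟩` and
`Trans(X) ≅ E₈^{⊕2} ⊕ U^{⊕2} ⊕ K₂₃`; `Inv(f) = NS(X)` and `Orth(f) = Trans(X)`."
[cite: BoissiereCamereMongardiSarti2016, Thm. 1.1, Thm. 6.1, §1 (p. 3) and §3 (pp. 5–6)] -/
def BCMS2016_K3HilbertSquareType_nonsymplecticAutomorphism_order23 : Prop :=
  ∃ (X : Motives.SchemeOver ℂ) (f : X ⟶ X),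
    Motives.IsSmoothProjective 4 X ∧ IsOfK3HilbertSquareType X ∧
    End.of f ^ 23 = 1 ∧ f ≠ 𝟙 X ∧
    (∃ ζ : ℂ, IsPrimitiveRoot ζ 23 ∧
      ∀ τ : HodgeTheory.complexBetti X 2, HodgeTheory.IsOfHodgeType 4 X 2 2 0 τ →
        HodgeTheory.complexBetti.map f 2 τ = ζ • τ) ∧
    Module.finrank ℂ (HodgeTheory.complexBetti X 2) = 23 ∧
    Module.finrank ℂ (HodgeTheory.algebraicClasses X 1) = 1 ∧
    (∀ c : HodgeTheory.complexBetti X (2 * 1),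
      HodgeTheory.complexBetti.map f (2 * 1) c = c ↔ c ∈ HodgeTheory.algebraicClasses X 1) ∧
    (∀ ζ : ℂ, IsPrimitiveRoot ζ 23 →
      Module.finrank ℂ
          (LinearMap.ker ((HodgeTheory.complexBetti.map f 2).hom - ζ • LinearMap.id)) = 1)

namespace BCMS2016_K3HilbertSquareType_nonsymplecticAutomorphism_order23

/-- Consumer shape: a smooth projective `K3^[2]`-type fourfold with Picard number one carrying an
automorphism of order `23` exists. [cite: BoissiereCamereMongardiSarti2016, Thm. 1.1] -/
theorem exists_picardOne (h : BCMS2016_K3HilbertSquareType_nonsymplecticAutomorphism_order23) :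
    ∃ (X : Motives.SchemeOver ℂ) (f : X ⟶ X),
      Motives.IsSmoothProjective 4 X ∧ IsOfK3HilbertSquareType X ∧ End.of f ^ 23 = 1 ∧ f ≠ 𝟙 X ∧
        Module.finrank ℂ (HodgeTheory.algebraicClasses X 1) = 1 := by
  obtain ⟨X, f, hX, hK3, h23, hne, -, -, hρ, -, -⟩ := h
  exact ⟨X, f, hX, hK3, h23, hne, hρ⟩

/-- Consumer shape: on the BCMS fourfold, a divisor class is fixed by `f^*` and a class fixed by `f^*`
is a divisor class (`Inv(f) ⊗ ℂ = NS(X) ⊗ ℂ`); in particular `f^*` has no non-zero fixed vector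
outside `N¹H²`. [cite: BoissiereCamereMongardiSarti2016, Thm. 6.1] -/
theorem exists_fixed_iff_mem_algebraicClasses
    (h : BCMS2016_K3HilbertSquareType_nonsymplecticAutomorphism_order23) :
    ∃ (X : Motives.SchemeOver ℂ) (f : X ⟶ X),
      Motives.IsSmoothProjective 4 X ∧ End.of f ^ 23 = 1 ∧
        (∀ c : HodgeTheory.complexBetti X (2 * 1),
          HodgeTheory.complexBetti.map f (2 * 1) c = c ↔ c ∈ HodgeTheory.algebraicClasses X 1) := by
  obtain ⟨X, f, hX, -, h23, -, -, -, -, hfix, -⟩ := h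
  exact ⟨X, f, hX, h23, hfix⟩

end BCMS2016_K3HilbertSquareType_nonsymplecticAutomorphism_order23

end Literature.AlgebraicGeometry.Hyperkaehler

end
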